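import Literature.Analysis.Approximation.TuranNazarovZeroFree
import Literature.Analysis.Complex.EntireQuotientOrder
import HarnessLib

/-!
# Hadamard's minimum-modulus theorem — the core estimate (case `f(0) ≠ 0`)

`Literature/Analysis/Complex/HadamardMinimumModulusCore.lean`.  Everything here is PROVED.  The core case of
Hadamard's minimum-modulus theorem (Titchmarsh, *The Theory of Functions*, 2nd ed. 1939, §8.711; Boas,
*Entire Functions* 1954, Thm. 2.7.4): an entire `f` with `f(0) ≠ 0` and `‖f z‖ ≤ C e^{‖z‖^σ}` (`σ > 0`) has,
for every `τ > σ` and every `R`, a whole circle `|z| = r > R` on which `|f| > e^{−r^τ}`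
(`exists_circle_of_apply_zero_ne`).  The general statement and the discharge of the named fact
`Titchmarsh1939_thm_8_711` are in `HadamardMinimumModulusProofs.lean`.

The proof is elementary and is NOT the printed route through Hadamard's factorisation: extraction of the
zeros in `|z| ≤ 3s` (`TuranNazarov.extract_zeros`, from Mathlib's `MeromorphicOn.extract_zeros_poles`),
Jensen's count (`TuranNazarov.count_le_jensen`), the Poisson–Jensen bound for the holomorphic quotient
`P/f` (`log_norm_le_three_mul_of_mul_eq`, Rubel–Colliander Ch. 8) and a zero-avoiding radius in `[s/2, s]`
by pigeonhole; the private lemmas below are the function-free ingredients (pigeonhole, bounds for the zero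
polynomial, and the real-variable bookkeeping `O(s^σ log s) < (s/2)^τ`).

References: [Titchmarsh1939] §8.71–§8.72 [galaxy:panama:407274568810535, chars 525900–529400];
[Boas1954] Thm. 2.7.4, p. 26 [corpus:book:boasnd-entire-functions p0026 L13–L15]; [RubelColliander1996]
Ch. 8.  Cell `rh-split`, seat `rh-split-typer-2` g4.
-/

noncomputable section

open Complex Metric Set Real Filter Topology

namespace Literature.Analysis.Complex

namespace HadamardMinimumModulus

open Literature.Analysis.Approximation.TuranNazarov (extract_zeros count_le_jensen)


/-- Pigeonhole: among the `k + 1` points `a + 2ηj` (`j ≤ k = #T`) one is at distance `≥ η` from every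
element of the finite set `T ⊆ ℝ`. [folklore] -/
private theorem exists_far_from_finset (T : Finset ℝ) (a : ℝ) {η : ℝ} (hη : 0 < η) :
    ∃ j : ℕ, j ≤ T.card ∧ ∀ x ∈ T, η ≤ |a + 2 * η * j - x| := by
  classical
  by_contra! hcon
  choose! g hgT hg using hcon
  have hmaps : Set.MapsTo g (Finset.range (T.card + 1)) T := fun j hj ↦
    hgT j (Nat.lt_succ_iff.mp (Finset.mem_range.mp hj))
  obtain ⟨i, hi, j, hj, hij, hgij⟩ :=
    Finset.exists_ne_map_eq_of_card_lt_of_maps_to (by simp) hmaps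
  have hi' : i ≤ T.card := Nat.lt_succ_iff.mp (Finset.mem_range.mp hi)
  have hj' : j ≤ T.card := Nat.lt_succ_iff.mp (Finset.mem_range.mp hj)
  have h1 := hg i hi'
  have h2 := hg j hj'
  rw [hgij] at h1
  have h3 : |(a + 2 * η * i - g j) - (a + 2 * η * j - g j)| < η + η :=
    (abs_sub _ _).trans_lt (add_lt_add h1 h2)
  have h4 : |(2 * η) * ((i : ℝ) - j)| < 2 * η := by
    have : (a + 2 * η * i - g j) - (a + 2 * η * j - g j) = (2 * η) * ((i : ℝ) - j) := by ring
    rw [this] at h3; linarith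
  rw [abs_mul, abs_of_pos (by positivity)] at h4
  have h5 : |((i : ℝ) - j)| < 1 := by
    by_contra! h; nlinarith
  have h6 : (1 : ℝ) ≤ |((i : ℝ) - j)| := by
    rcases Nat.lt_or_gt_of_ne hij with h | h
    · have : (1 : ℝ) ≤ (j : ℝ) - i := by
        have : i + 1 ≤ j := h
        have := (Nat.cast_le (α := ℝ)).mpr this
        push_cast at this; linarith
      rw [abs_sub_comm]; exact this.trans (le_abs_self _)
    · have : (1 : ℝ) ≤ (i : ℝ) - j := by
        have : j + 1 ≤ i := h
        have := (Nat.cast_le (α := ℝ)).mpr this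
        push_cast at this; linarith
      exact this.trans (le_abs_self _)
  linarith

/-- Upper bound for the zero polynomial `∏ (z − u)^{n u}` when every factor has modulus `≤ B`.
[folklore] -/
private theorem norm_prod_pow_le {Z : Finset ℂ} {n : ℂ → ℕ} {z : ℂ} {B : ℝ}
    (h : ∀ u ∈ Z, ‖z - u‖ ≤ B) :
    ‖∏ u ∈ Z, (z - u) ^ n u‖ ≤ B ^ ∑ u ∈ Z, n u := by
  rw [norm_prod, ← Finset.prod_pow_eq_pow_sum]
  refine Finset.prod_le_prod (fun u _ ↦ norm_nonneg _) fun u hu ↦ ?_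
  rw [norm_pow]
  exact pow_le_pow_left₀ (norm_nonneg _) (h u hu) _

/-- Lower bound for the zero polynomial `∏ (z − u)^{n u}` when every factor has modulus `≥ η ≥ 0`.
[folklore] -/
private theorem le_norm_prod_pow {Z : Finset ℂ} {n : ℂ → ℕ} {z : ℂ} {η : ℝ} (hη : 0 ≤ η)
    (h : ∀ u ∈ Z, η ≤ ‖z - u‖) :
    η ^ ∑ u ∈ Z, n u ≤ ‖∏ u ∈ Z, (z - u) ^ n u‖ := by
  rw [norm_prod, ← Finset.prod_pow_eq_pow_sum]
  refine Finset.prod_le_prod (fun u _ ↦ pow_nonneg hη _) fun u hu ↦ ?_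
  rw [norm_pow]
  exact pow_le_pow_left₀ hη (h u hu) _

/-- The real-variable bookkeeping of the proof: with `N ≤ K s^σ` zeros, the losses
`N log(4(N+1)) + 3(N log(6s) + ℓ + (3s)^σ)` are `< (s/2)^{σ+2κ}` once `s^κ` beats an explicit constant.
[folklore] -/
private theorem loss_lt_rpow {σ κ ℓ K N s : ℝ} (hσ : 0 < σ) (hκ : 0 < κ) (hℓ : 0 ≤ ℓ) (hK : 1 ≤ K)
    (hs : 1 ≤ s) (hN0 : 0 ≤ N) (hN : N ≤ K * s ^ σ)
    (hbig : (K * Real.log 8 + K * Real.log K + K * σ / κ + 3 * K * Real.log 6 + 3 * K / κ + 3 * ℓ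
      + 3 ^ (σ + 1)) * 2 ^ (σ + 2 * κ) < s ^ κ) :
    N * Real.log (4 * (N + 1)) + 3 * (N * Real.log (6 * s) + ℓ + (3 * s) ^ σ)
      < (s / 2) ^ (σ + 2 * κ) := by
  have hs0 : 0 < s := by linarith
  have hK0 : 0 < K := by linarith
  have hL0 : 0 ≤ Real.log s := Real.log_nonneg hs
  have hsσ : 1 ≤ s ^ σ := Real.one_le_rpow hs hσ.le
  have hsσ0 : 0 < s ^ σ := by linarith
  have hsκ : 0 < s ^ κ := Real.rpow_pos_of_pos hs0 κ
  have hWeq : s ^ (σ + κ) = s ^ σ * s ^ κ := Real.rpow_add hs0 σ κ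
  have hσW : s ^ σ ≤ s ^ (σ + κ) := Real.rpow_le_rpow_of_exponent_le hs (by linarith)
  have hW0 : 0 < s ^ (σ + κ) := by linarith
  -- `N + 1 ≤ 2 K s^σ` and `log (4 (N+1)) ≤ log 8 + log K + σ log s`
  have hKs : 1 ≤ K * s ^ σ := one_le_mul_of_one_le_of_one_le hK hsσ
  have hlog4 : Real.log (4 * (N + 1)) ≤ Real.log 8 + Real.log K + σ * Real.log s := by
    have h8 : Real.log (8 * (K * s ^ σ)) = Real.log 8 + Real.log K + σ * Real.log s := by
      rw [Real.log_mul (by norm_num) (by positivity), Real.log_mul hK0.ne' hsσ0.ne',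
        Real.log_rpow hs0]; ring
    rw [← h8]
    exact Real.log_le_log (by positivity) (by linarith)
  have hlog4_nn : 0 ≤ Real.log (4 * (N + 1)) := Real.log_nonneg (by linarith)
  have hlog6 : Real.log (6 * s) = Real.log 6 + Real.log s := Real.log_mul (by norm_num) hs0.ne'
  have hlog6_nn : 0 ≤ Real.log 6 := Real.log_nonneg (by norm_num)
  have hlog8_nn : 0 ≤ Real.log 8 := Real.log_nonneg (by norm_num)
  have hlogK_nn : 0 ≤ Real.log K := Real.log_nonneg hK
  have h3s : (3 * s) ^ σ = 3 ^ σ * s ^ σ := Real.mul_rpow (by norm_num) hs0.le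
  have h3σ1 : (3 : ℝ) ^ (σ + 1) = 3 * 3 ^ σ := by
    rw [Real.rpow_add (by norm_num), Real.rpow_one]; ring
  have h3σ_nn : 0 ≤ (3 : ℝ) ^ σ := by positivity
  -- `log s ≤ s^κ / κ`, hence `s^σ log s ≤ s^(σ+κ)/κ`
  have hLκ : Real.log s ≤ s ^ κ / κ := Real.log_le_rpow_div hs0.le hκ
  have hσL : s ^ σ * Real.log s ≤ s ^ (σ + κ) / κ := by
    rw [hWeq, mul_div_assoc]
    exact mul_le_mul_of_nonneg_left hLκ hsσ0.le
  -- the zero count against the two logarithms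
  have hNlog4 : N * Real.log (4 * (N + 1)) ≤
      (K * s ^ σ) * (Real.log 8 + Real.log K) + K * σ * (s ^ σ * Real.log s) := by
    calc N * Real.log (4 * (N + 1)) ≤ (K * s ^ σ) * (Real.log 8 + Real.log K + σ * Real.log s) :=
          mul_le_mul hN hlog4 hlog4_nn (by positivity)
      _ = (K * s ^ σ) * (Real.log 8 + Real.log K) + K * σ * (s ^ σ * Real.log s) := by ring
  have hNlog6 : N * Real.log (6 * s) ≤ (K * s ^ σ) * Real.log 6 + K * (s ^ σ * Real.log s) := by
    rw [hlog6]
    calc N * (Real.log 6 + Real.log s) ≤ (K * s ^ σ) * (Real.log 6 + Real.log s) :=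
          mul_le_mul_of_nonneg_right hN (by positivity)
      _ = (K * s ^ σ) * Real.log 6 + K * (s ^ σ * Real.log s) := by ring
  -- everything as a multiple of `W = s^(σ+κ)`
  have hA1 : (K * s ^ σ) * (Real.log 8 + Real.log K) ≤ (K * (Real.log 8 + Real.log K)) * s ^ (σ + κ) := by
    rw [show (K * s ^ σ) * (Real.log 8 + Real.log K) = (K * (Real.log 8 + Real.log K)) * s ^ σ by ring]
    exact mul_le_mul_of_nonneg_left hσW (by positivity)
  have hA2 : K * σ * (s ^ σ * Real.log s) ≤ K * σ * (s ^ (σ + κ) / κ) :=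
    mul_le_mul_of_nonneg_left hσL (by positivity)
  have hA3 : (K * s ^ σ) * Real.log 6 ≤ (K * Real.log 6) * s ^ (σ + κ) := by
    rw [show (K * s ^ σ) * Real.log 6 = (K * Real.log 6) * s ^ σ by ring]
    exact mul_le_mul_of_nonneg_left hσW (by positivity)
  have hA4 : K * (s ^ σ * Real.log s) ≤ K * (s ^ (σ + κ) / κ) :=
    mul_le_mul_of_nonneg_left hσL hK0.le
  have hA5 : ℓ ≤ ℓ * s ^ (σ + κ) := le_mul_of_one_le_right hℓ (hsσ.trans hσW)
  have hA6 : (3 * s) ^ σ ≤ 3 ^ σ * s ^ (σ + κ) := by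
    rw [h3s]; exact mul_le_mul_of_nonneg_left hσW h3σ_nn
  set A : ℝ := K * Real.log 8 + K * Real.log K + K * σ / κ + 3 * K * Real.log 6 + 3 * K / κ + 3 * ℓ
      + 3 ^ (σ + 1) with hA
  have hsum : N * Real.log (4 * (N + 1)) + 3 * (N * Real.log (6 * s) + ℓ + (3 * s) ^ σ)
      ≤ A * s ^ (σ + κ) := by
    have hAe : A * s ^ (σ + κ) = (K * (Real.log 8 + Real.log K)) * s ^ (σ + κ)
        + K * σ * (s ^ (σ + κ) / κ) + 3 * ((K * Real.log 6) * s ^ (σ + κ) + K * (s ^ (σ + κ) / κ))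
        + 3 * (ℓ * s ^ (σ + κ)) + 3 * (3 ^ σ * s ^ (σ + κ)) := by
      rw [hA, h3σ1]; field_simp; ring
    rw [hAe]
    linarith [hNlog4, hNlog6, hA1, hA2, hA3, hA4, hA5, hA6]
  -- compare with `(s/2)^(σ+2κ) = s^(σ+κ) s^κ / 2^(σ+2κ)`
  have h2pos : (0 : ℝ) < 2 ^ (σ + 2 * κ) := by positivity
  have hrhs : (s / 2) ^ (σ + 2 * κ) = s ^ (σ + κ) * s ^ κ / 2 ^ (σ + 2 * κ) := by
    rw [Real.div_rpow hs0.le (by norm_num), show σ + 2 * κ = (σ + κ) + κ by ring, Real.rpow_add hs0]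
  rw [hrhs, lt_div_iff₀ h2pos]
  calc (N * Real.log (4 * (N + 1)) + 3 * (N * Real.log (6 * s) + ℓ + (3 * s) ^ σ)) * 2 ^ (σ + 2 * κ)
      ≤ A * s ^ (σ + κ) * 2 ^ (σ + 2 * κ) := mul_le_mul_of_nonneg_right hsum h2pos.le
    _ = s ^ (σ + κ) * (A * 2 ^ (σ + 2 * κ)) := by ring
    _ < s ^ (σ + κ) * s ^ κ := mul_lt_mul_of_pos_left hbig hW0

/-- **Hadamard's minimum-modulus theorem, core case `f(0) ≠ 0`.** If `f` is entire with
`‖f z‖ ≤ C e^{‖z‖^σ}` (`σ > 0`) and `f(0) ≠ 0`, then for every `τ > σ` and every `R` there is a radius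
`r > R` with `|f(z)| > e^{−r^τ}` on the whole circle `|z| = r`.  Proof (not the printed one): extract the
zeros in `|z| ≤ 3s` (`f = P·g`), count them by Jensen (`N ≤ K s^σ`), bound `log|1/g| ≤ 3(log⁺ M_P +
log M_f(3s) − log|f(0)|)` on `|z| ≤ s` by the Poisson–Jensen quotient bound, and pick a radius
`t ∈ [s/2, s]` at distance `≥ s/(4(N+1))` from every `|zero|` (pigeonhole), where `log|P| ≥ −N log(4(N+1))`.
[cite: Titchmarsh1939, §8.711; Boas1954, Thm. 2.7.4] -/
theorem exists_circle_of_apply_zero_ne {f : ℂ → ℂ} (hf : Differentiable ℂ f) (h0 : f 0 ≠ 0)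
    {σ τ C : ℝ} (hσ : 0 < σ) (hστ : σ < τ) (hC : ∀ z, ‖f z‖ ≤ C * Real.exp (‖z‖ ^ σ)) (R : ℝ) :
    ∃ r : ℝ, R < r ∧ ∀ z : ℂ, ‖z‖ = r → Real.exp (-(r ^ τ)) < ‖f z‖ := by
  classical
  have hfa : ∀ z, AnalyticAt ℂ f z := fun z ↦ hf.analyticAt z
  -- normalise the constant: `C' = max C 1 ≥ 1`
  obtain ⟨C', hC'1, hC'⟩ : ∃ C' : ℝ, 1 ≤ C' ∧ ∀ z, ‖f z‖ ≤ C' * Real.exp (‖z‖ ^ σ) :=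
    ⟨max C 1, le_max_right _ _, fun z ↦
      (hC z).trans (mul_le_mul_of_nonneg_right (le_max_left _ _) (Real.exp_pos _).le)⟩
  have hC'0 : 0 < C' := by linarith
  have ha : 0 < ‖f 0‖ := norm_pos_iff.mpr h0
  have haC : ‖f 0‖ ≤ C' := by
    have := hC' 0
    rwa [norm_zero, Real.zero_rpow hσ.ne', Real.exp_zero, mul_one] at this
  obtain ⟨ℓ, hℓdef⟩ : ∃ ℓ : ℝ, ℓ = Real.log C' - Real.log ‖f 0‖ := ⟨_, rfl⟩
  have hℓ : 0 ≤ ℓ := by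
    have := Real.log_le_log ha haC; rw [hℓdef]; linarith
  obtain ⟨κ, hκdef⟩ : ∃ κ : ℝ, κ = (τ - σ) / 2 := ⟨_, rfl⟩
  have hκ : 0 < κ := by rw [hκdef]; linarith
  have hτ : τ = σ + 2 * κ := by rw [hκdef]; ring
  obtain ⟨K, hKdef⟩ : ∃ K : ℝ, K = ℓ + 9 ^ σ := ⟨_, rfl⟩
  have h9 : (1 : ℝ) ≤ 9 ^ σ := Real.one_le_rpow (by norm_num) hσ.le
  have hK : 1 ≤ K := by rw [hKdef]; linarith
  obtain ⟨A, hAdef⟩ : ∃ A : ℝ, A = K * Real.log 8 + K * Real.log K + K * σ / κ + 3 * K * Real.log 6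
      + 3 * K / κ + 3 * ℓ + 3 ^ (σ + 1) := ⟨_, rfl⟩
  -- choose the scale `s`
  obtain ⟨s, hsbig, hs1, hsR⟩ : ∃ s : ℝ, A * 2 ^ (σ + 2 * κ) < s ^ κ ∧ 1 ≤ s ∧ 2 * R < s := by
    have h1 := (tendsto_rpow_atTop hκ).eventually_gt_atTop (A * 2 ^ (σ + 2 * κ))
    have h2 := eventually_ge_atTop (1 : ℝ)
    have h3 := eventually_gt_atTop (2 * R)
    obtain ⟨s, hs⟩ := ((h1.and h2).and h3).exists
    exact ⟨s, hs.1.1, hs.1.2, hs.2⟩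
  have hs0 : 0 < s := by linarith
  -- extract the zeros in `|z| ≤ 3s`
  have hfne : f ≠ 0 := fun h ↦ h0 (by simp [h])
  obtain ⟨Z, n, g, hZ, hn, hn1, hga, hg0, hfac⟩ :=
    extract_zeros hfa hfne 0 (ρ := 3 * s) (R₀ := 3 * s + 1) (by linarith)
  obtain ⟨N, hNdef⟩ : ∃ N : ℕ, N = ∑ u ∈ Z, n u := ⟨_, rfl⟩
  obtain ⟨P, hPdef⟩ : ∃ P : ℂ → ℂ, ∀ z, P z = ∏ u ∈ Z, (z - u) ^ n u := ⟨_, fun _ ↦ rfl⟩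
  have hfacP : ∀ z ∈ ball (0 : ℂ) (3 * s + 1), f z = P z * g z := fun z hz ↦ by
    rw [hPdef]; exact hfac z hz
  have hZball : ∀ u ∈ Z, u ∈ closedBall (0 : ℂ) (3 * s) := fun u hu ↦ ((hZ u).1 hu).2
  have hZnorm : ∀ u ∈ Z, ‖u‖ ≤ 3 * s := fun u hu ↦
    mem_closedBall_zero_iff.mp (hZball u hu)
  -- Jensen: `N ≤ ℓ + (3 e s)^σ ≤ K s^σ`
  have hsσ : 1 ≤ s ^ σ := Real.one_le_rpow hs1 hσ.le
  have hNle : (N : ℝ) ≤ K * s ^ σ := by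
    obtain ⟨Rj, hRj⟩ : ∃ Rj : ℝ, Rj = 3 * s * Real.exp 1 := ⟨_, rfl⟩
    obtain ⟨M, hM⟩ : ∃ M : ℝ, M = C' * Real.exp (Rj ^ σ) := ⟨_, rfl⟩
    have he1 : 1 < Real.exp 1 := Real.one_lt_exp_iff.mpr one_pos
    have hRj0 : 0 < Rj := by rw [hRj]; positivity
    have hrR : 3 * s < Rj := by rw [hRj]; nlinarith
    have hM1 : 1 ≤ M := hM ▸ one_le_mul_of_one_le_of_one_le hC'1 (Real.one_le_exp (by positivity))
    have hbd : ∀ z ∈ sphere (0 : ℂ) Rj, ‖f z‖ ≤ M := by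
      intro z hz
      have hz' : ‖z‖ = Rj := mem_sphere_zero_iff_norm.mp hz
      calc ‖f z‖ ≤ C' * Real.exp (‖z‖ ^ σ) := hC' z
        _ = M := by rw [hz', hM]
    have hJ := count_le_jensen hfa (c' := 0) Z n hZball hn (by positivity : (0 : ℝ) < 3 * s) hrR
      hM1 h0 hbd
    have hratio : Rj / (3 * s) = Real.exp 1 := by rw [hRj]; field_simp
    rw [hratio, Real.log_exp, div_one] at hJ
    have hM0 : 0 < M := by linarith
    have hlogM : Real.log (M / ‖f 0‖) = ℓ + Rj ^ σ := by
      rw [Real.log_div hM0.ne' ha.ne', hM, Real.log_mul hC'0.ne' (Real.exp_pos _).ne',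
        Real.log_exp, hℓdef]; ring
    rw [← hNdef, hlogM] at hJ
    have he3 : Real.exp 1 ≤ 3 := by have := Real.exp_one_lt_d9; linarith
    have hRj9 : Rj ≤ 9 * s := by rw [hRj]; nlinarith
    have hRjσ : Rj ^ σ ≤ 9 ^ σ * s ^ σ := by
      rw [← Real.mul_rpow (by norm_num) hs0.le]
      exact Real.rpow_le_rpow hRj0.le hRj9 hσ.le
    have hℓs : ℓ ≤ ℓ * s ^ σ := le_mul_of_one_le_right hℓ hsσ
    calc (N : ℝ) ≤ ℓ + Rj ^ σ := hJ
      _ ≤ ℓ * s ^ σ + 9 ^ σ * s ^ σ := add_le_add hℓs hRjσ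
      _ = K * s ^ σ := by rw [hKdef]; ring
  -- Poisson–Jensen bound for `1/g` on `|w| ≤ s`
  have hcb : closedBall (0 : ℂ) (3 * s) ⊆ ball (0 : ℂ) (3 * s + 1) :=
    closedBall_subset_ball (by linarith)
  have hFa : AnalyticOnNhd ℂ (fun z ↦ (g z)⁻¹) (closedBall (0 : ℂ) (3 * s)) := fun z hz ↦
    (hga z (hcb hz)).inv (hg0 z hz)
  have hfa' : AnalyticOnNhd ℂ f (closedBall (0 : ℂ) (3 * s)) := fun z _ ↦ hfa z
  have hq : ∀ z ∈ closedBall (0 : ℂ) (3 * s), (fun z ↦ (g z)⁻¹) z * f z = P z := by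
    intro z hz
    show (g z)⁻¹ * f z = P z
    rw [hfacP z (hcb hz), mul_comm ((g z)⁻¹), mul_assoc, mul_inv_cancel₀ (hg0 z hz), mul_one]
  have hMg : ∀ z ∈ closedBall (0 : ℂ) (3 * s), ‖P z‖ ≤ (6 * s) ^ N := by
    intro z hz
    have hz' : ‖z‖ ≤ 3 * s := by simpa using hz
    rw [hPdef, hNdef]
    refine norm_prod_pow_le fun u hu ↦ ?_
    calc ‖z - u‖ ≤ ‖z‖ + ‖u‖ := norm_sub_le _ _
      _ ≤ 3 * s + 3 * s := add_le_add hz' (hZnorm u hu)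
      _ = 6 * s := by ring
  have hMh : ∀ z ∈ closedBall (0 : ℂ) (3 * s), ‖f z‖ ≤ C' * Real.exp ((3 * s) ^ σ) := by
    intro z hz
    have hz' : ‖z‖ ≤ 3 * s := by simpa using hz
    have : ‖z‖ ^ σ ≤ (3 * s) ^ σ := Real.rpow_le_rpow (norm_nonneg _) hz' hσ.le
    calc ‖f z‖ ≤ C' * Real.exp (‖z‖ ^ σ) := hC' z
      _ ≤ C' * Real.exp ((3 * s) ^ σ) := by gcongr
  have hPJ : ∀ w ∈ closedBall (0 : ℂ) s, Real.log ‖(g w)⁻¹‖ ≤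
      3 * (log⁺ ((6 * s) ^ N) + log⁺ (C' * Real.exp ((3 * s) ^ σ)) - Real.log ‖f 0‖) :=
    fun w hw ↦ log_norm_le_three_mul_of_mul_eq hs0 hfa' hFa hq h0 hMg hMh hw
  -- evaluate the `log⁺`'s
  have h6s : (1 : ℝ) ≤ 6 * s := by linarith
  have hposP : log⁺ ((6 * s) ^ N) = N * Real.log (6 * s) := by
    rw [Real.posLog_eq_log (by rw [abs_of_nonneg (by positivity)]; exact one_le_pow₀ h6s),
      Real.log_pow]
  have hposf : log⁺ (C' * Real.exp ((3 * s) ^ σ)) = Real.log C' + (3 * s) ^ σ := by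
    have h1 : 1 ≤ C' * Real.exp ((3 * s) ^ σ) :=
      one_le_mul_of_one_le_of_one_le hC'1 (Real.one_le_exp (by positivity))
    rw [Real.posLog_eq_log (by rwa [abs_of_nonneg (by positivity)]),
      Real.log_mul hC'0.ne' (Real.exp_pos _).ne', Real.log_exp]
  -- a zero-avoiding radius `t ∈ [s/2, s]`
  obtain ⟨T, hTdef⟩ : ∃ T : Finset ℝ, T = Z.image (fun u ↦ ‖u‖) := ⟨_, rfl⟩
  obtain ⟨k, hkdef⟩ : ∃ k : ℕ, k = T.card := ⟨_, rfl⟩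
  have hkN : (k : ℝ) ≤ N := by
    have h1 : T.card ≤ Z.card := hTdef ▸ Finset.card_image_le
    have h2 : Z.card ≤ N := by
      rw [hNdef, Finset.card_eq_sum_ones]
      exact Finset.sum_le_sum fun u hu ↦ hn1 u hu
    rw [hkdef]; exact_mod_cast h1.trans h2
  have hk0 : (0 : ℝ) < (k : ℝ) + 1 := by positivity
  obtain ⟨η, hηdef⟩ : ∃ η : ℝ, η = s / (4 * ((k : ℝ) + 1)) := ⟨_, rfl⟩
  have hη : 0 < η := by rw [hηdef]; exact div_pos hs0 (by linarith)
  obtain ⟨j, hj, hfar⟩ := exists_far_from_finset T (s / 2 + η) hη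
  rw [← hkdef] at hj
  obtain ⟨t, htdef⟩ : ∃ t : ℝ, t = s / 2 + η + 2 * η * j := ⟨_, rfl⟩
  have hjR : (j : ℝ) ≤ k := by exact_mod_cast hj
  have hηk : η * (4 * ((k : ℝ) + 1)) = s := by
    rw [hηdef]; exact div_mul_cancel₀ s (by linarith)
  have ht1 : s / 2 ≤ t := by
    have : 0 ≤ 2 * η * j := by positivity
    rw [htdef]; linarith
  have ht2 : t ≤ s := by
    have : η + 2 * η * j ≤ s / 2 := by nlinarith
    rw [htdef]; linarith
  have htR : R < t := by linarith
  refine ⟨t, htR, fun w hw ↦ ?_⟩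
  -- on the circle `‖w‖ = t`
  have hws : w ∈ closedBall (0 : ℂ) s := by
    rw [mem_closedBall_zero_iff, hw]; exact ht2
  have hw3 : w ∈ closedBall (0 : ℂ) (3 * s) := closedBall_subset_closedBall (by linarith) hws
  have hfar' : ∀ u ∈ Z, η ≤ ‖w - u‖ := by
    intro u hu
    have h1 : η ≤ |s / 2 + η + 2 * η * j - ‖u‖| :=
      hfar ‖u‖ (hTdef ▸ Finset.mem_image_of_mem (fun u ↦ ‖u‖) hu)
    rw [← htdef, ← hw] at h1
    exact h1.trans (abs_norm_sub_norm_le w u)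
  have hPw : η ^ N ≤ ‖P w‖ := by rw [hPdef, hNdef]; exact le_norm_prod_pow hη.le hfar'
  have hP0 : P w ≠ 0 := by
    intro h; rw [h, norm_zero] at hPw; exact absurd hPw (not_le.mpr (pow_pos hη N))
  have hgw : g w ≠ 0 := hg0 w hw3
  have hfw : f w = P w * g w := hfacP w (hcb hw3)
  have hf0w : f w ≠ 0 := by rw [hfw]; exact mul_ne_zero hP0 hgw
  -- logarithms
  have hlogf : Real.log ‖f w‖ = Real.log ‖P w‖ + Real.log ‖g w‖ := by
    rw [hfw, norm_mul, Real.log_mul (norm_ne_zero_iff.mpr hP0) (norm_ne_zero_iff.mpr hgw)]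
  have hlogg : -(3 * (N * Real.log (6 * s) + ℓ + (3 * s) ^ σ)) ≤ Real.log ‖g w‖ := by
    have := hPJ w hws
    rw [hposP, hposf, norm_inv, Real.log_inv] at this
    rw [hℓdef]; linarith
  have hlogP : (N : ℝ) * Real.log η ≤ Real.log ‖P w‖ := by
    rw [← Real.log_pow]
    exact Real.log_le_log (pow_pos hη N) hPw
  -- `log η ≥ -log (4 (N + 1))` since `η = s/(4(#T+1)) ≥ 1/(4(N+1))`
  have hN0 : (0 : ℝ) ≤ N := Nat.cast_nonneg N
  have hlogη : -Real.log (4 * (N + 1)) ≤ Real.log η := by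
    rw [← Real.log_inv]
    have h4N : (0 : ℝ) < 4 * ((N : ℝ) + 1) := by linarith
    apply Real.log_le_log (inv_pos.mpr h4N)
    -- `(4 (N+1))⁻¹ ≤ η` iff `1 ≤ η ⬝ 4 (N + 1)`; and `η ⬝ 4 (N+1) ≥ η ⬝ 4 (k+1) = s ≥ 1`
    rw [inv_le_iff_one_le_mul₀ h4N]
    have : η * (4 * ((k : ℝ) + 1)) ≤ η * (4 * ((N : ℝ) + 1)) :=
      mul_le_mul_of_nonneg_left (by linarith) hη.le
    linarith
  have hlogP' : -((N : ℝ) * Real.log (4 * (N + 1))) ≤ Real.log ‖P w‖ := by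
    have := mul_le_mul_of_nonneg_left hlogη (Nat.cast_nonneg N)
    linarith
  -- assemble
  have hloss := loss_lt_rpow hσ hκ hℓ hK hs1 (Nat.cast_nonneg N) hNle
    (by rw [hAdef] at hsbig; exact hsbig)
  have hst : (s / 2) ^ τ ≤ t ^ τ := Real.rpow_le_rpow (by positivity) ht1 (by linarith)
  rw [hτ] at hst
  rw [← Real.lt_log_iff_exp_lt (norm_pos_iff.mpr hf0w), hτ]
  linarith

end HadamardMinimumModulus

end Literature.Analysis.Complex

end
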